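import Summits.CriticalPhenomena.PercolationContinuityZ3.Theorems.PercNearOneGluingNoHeavyQuantUniversalCertificate
import Summits.CriticalPhenomena.PercolationContinuityZ3.Theorems.PercNearOneGluingNoHeavyQuantRegimeMTilt
import HarnessLib

/-!
# QUANT lane R8, heavy node: every row `d < min(qT₁, qT₂)` of the conclusion of `LawDec.TLBGateConvClosedHeavy` holds — for EVERY floor
# `0 < y < 1` (`LawDec.gate_lconv_row_of_lt_min`)

builds on p205010 (kernel theorem, internal audit signed; external expert review pending)

Support file (`--supports stmt-CriticalPhenomena-4575`), QUANT lane typer seat prim-quant-stmt (gen 34); memo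
`run/shared/lean/prim/quant/prim-quant-stmt-g34/PHANTOM-QFREE-G34.md` §3.  Theorems only, standard axioms, no sorries.
= the q-free principle (`…QuantUniversalCertificate`, ✓ p377956) fed with the regime-M pure-tilt certificate (`…QuantRegimeMTilt`,
`regimeM_certificate`, λ = κ = 0).  In the binder of `LawDec.TLBGateConvClosedHeavy` (`…QuantTLBClosureHeavy`) this discharges every row `d` of the
conclusion with `d < q·min(T₁,T₂)` and does not use `1/2 ≤ y` (the factors' two-layer rows `hB1`, `hB2` are passed to the principle but multiply zero
weights).  The rows `d ≥ q·min(T₁,T₂)` are regime R (arm-2's S* + weight-1 reflections `c = 0` on the rows above `d`, memo §4).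
HONEST STATUS: `TLBGateConvClosedHeavy`, `FarTreeRowHeavy`, `FarTreeRow` OPEN until regime R is kernel.

[this work].  The gluing rows served [cite: KozmaNitzan2024, Conjecture 3 (p. 15)]; product measure [cite: Grimmett1999, §1.3 p. 10].
-/

noncomputable section

namespace Summit.CriticalPhenomena.PercolationContinuityZ3.Theorems

namespace Quant

open Finset

namespace LawDec

/-- **ROWS BELOW BOTH GATED TARGETS (regime M of the heavy node).**  In the binder of `LawDec.TLBGateConvClosedHeavy` but for ANY floor
`0 < y < 1`: for a layer `d` with `d < q·T₁` and `d < q·T₂`,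
`y/(1−y)·Σ_{h ≤ d} gate (lconv μ₁ μ₂) q h ≤ Σ_{h ≤ M₁+M₂, q(T₁+T₂) − d ≤ h} gate (lconv μ₁ μ₂) q h`. [this work] -/
theorem gate_lconv_row_of_lt_min (y q : ℝ) (M₁ M₂ d : ℕ) (μ₁ μ₂ : ℕ → ℝ)
    (hy0 : 0 < y) (hy1 : y < 1) (hq0 : 0 < q) (hq1 : q ≤ 1)
    (n1 : ∀ h, 0 ≤ μ₁ h) (z1 : ∀ h, M₁ < h → μ₁ h = 0) (s1 : ∑ h ∈ Finset.range (M₁ + 1), μ₁ h = 1)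
    (t1 : y * (M₁ : ℝ) ≤ q * ∑ h ∈ Finset.range (M₁ + 1), (h : ℝ) * μ₁ h)
    (n2 : ∀ h, 0 ≤ μ₂ h) (z2 : ∀ h, M₂ < h → μ₂ h = 0) (s2 : ∑ h ∈ Finset.range (M₂ + 1), μ₂ h = 1)
    (t2 : y * (M₂ : ℝ) ≤ q * ∑ h ∈ Finset.range (M₂ + 1), (h : ℝ) * μ₂ h)
    (hB1 : ∀ dd : ℕ, 2 * (dd : ℝ) < q * ∑ h ∈ Finset.range (M₁ + 1), (h : ℝ) * μ₁ h →
      y / (1 - y) * ∑ h ∈ Finset.range (dd + 1), gate μ₁ q h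
        ≤ ∑ h ∈ Finset.range (M₁ + 1), (if q * (∑ h ∈ Finset.range (M₁ + 1), (h : ℝ) * μ₁ h) - dd ≤ (h : ℝ) then gate μ₁ q h else 0))
    (hB2 : ∀ dd : ℕ, 2 * (dd : ℝ) < q * ∑ h ∈ Finset.range (M₂ + 1), (h : ℝ) * μ₂ h →
      y / (1 - y) * ∑ h ∈ Finset.range (dd + 1), gate μ₂ q h
        ≤ ∑ h ∈ Finset.range (M₂ + 1), (if q * (∑ h ∈ Finset.range (M₂ + 1), (h : ℝ) * μ₂ h) - dd ≤ (h : ℝ) then gate μ₂ q h else 0))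
    (hd1 : (d : ℝ) < q * ∑ h ∈ Finset.range (M₁ + 1), (h : ℝ) * μ₁ h)
    (hd2 : (d : ℝ) < q * ∑ h ∈ Finset.range (M₂ + 1), (h : ℝ) * μ₂ h) :
    y / (1 - y) * ∑ h ∈ Finset.range (d + 1), gate (lconv M₁ M₂ μ₁ μ₂) q h
      ≤ ∑ h ∈ Finset.range (M₁ + M₂ + 1),
        (if q * ((∑ h ∈ Finset.range (M₁ + 1), (h : ℝ) * μ₁ h) + ∑ h ∈ Finset.range (M₂ + 1), (h : ℝ) * μ₂ h) - d ≤ (h : ℝ)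
          then gate (lconv M₁ M₂ μ₁ μ₂) q h else 0) := by
  have e : q * ((∑ h ∈ Finset.range (M₁ + 1), (h : ℝ) * μ₁ h) + ∑ h ∈ Finset.range (M₂ + 1), (h : ℝ) * μ₂ h)
      = q * (∑ h ∈ Finset.range (M₁ + 1), (h : ℝ) * μ₁ h) + q * (∑ h ∈ Finset.range (M₂ + 1), (h : ℝ) * μ₂ h) := by ring
  rw [e]
  set t₁ : ℝ := q * ∑ h ∈ Finset.range (M₁ + 1), (h : ℝ) * μ₁ h with ht₁
  set t₂ : ℝ := q * ∑ h ∈ Finset.range (M₂ + 1), (h : ℝ) * μ₂ h with ht₂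
  have h1y : 0 < 1 - y := by linarith
  have hu0 : 0 < y / (1 - y) := div_pos hy0 h1y
  have hd0 : (0 : ℝ) ≤ d := Nat.cast_nonneg d
  have ht₁0 : 0 < t₁ := lt_of_le_of_lt hd0 hd1
  have ht₂0 : 0 < t₂ := lt_of_le_of_lt hd0 hd2
  -- `1 + 1/u = 1/y`: top-affordability reads `Mᵢ ≤ tᵢ(1 + 1/u)`
  have hinv : 1 + 1 / (y / (1 - y)) = 1 / y := by field_simp; ring
  have hM₁ : (M₁ : ℝ) ≤ t₁ * (1 + 1 / (y / (1 - y))) := by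
    rw [hinv, mul_one_div, le_div_iff₀ hy0]; linarith
  have hM₂ : (M₂ : ℝ) ≤ t₂ * (1 + 1 / (y / (1 - y))) := by
    rw [hinv, mul_one_div, le_div_iff₀ hy0]; linarith
  obtain ⟨ρ₂, hE0, hE1⟩ := regimeM_certificate (y / (1 - y)) t₁ t₂ M₁ M₂ d hu0 ht₁0 ht₂0 hM₁ hM₂ hd1 hd2
  have hk : 2 * (d : ℝ) < t₁ + t₂ := by linarith
  have hyu : (1 - y) / y = 1 / (y / (1 - y)) := by field_simp
  refine gate_lconv_row_of_universalCertificate y q t₁ t₂ M₁ M₂ d μ₁ μ₂ hy0 hy1 hq0 hq1 n1 z1 s1 n2 z2 s2 ht₁ ht₂ hk hB1 hB2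
    (fun _ _ => (0 : ℝ)) (fun _ _ => (0 : ℝ)) (fun _ => (y / (1 - y)) / (t₁ + t₂ - d)) ρ₂
    (fun _ _ => le_rfl) (fun _ _ h => (lt_irrefl _ h).elim) (fun _ _ => le_rfl) (fun _ _ h => (lt_irrefl _ h).elim) ?_ ?_
  · intro a ha s hs
    simp only [zero_mul, Finset.sum_const_zero, zero_add]
    exact hE0 a ha s hs
  · intro a ha s hs
    simp only [Finset.sum_const_zero, zero_add, hyu]
    exact hE1 a ha

end LawDec

end Quant

end Summit.CriticalPhenomena.PercolationContinuityZ3.Theorems
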